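import Literature.NumberTheory.EllipticCurves.LambdaAdicSelmerDataLevelProofs
import HarnessLib

/-!
# `𝔖_p(K_∞) = lim←_n S_p(E/K_n)` EXISTS and is UNIQUE as a `Λ = ℤ_p⟦T⟧`-module: discharge of the named
# fact `WeierstrassCurve.lambdaAdicSelmerData_exists_unique` (Perrin-Riou 1987 §0; Howard 2004 Def. 3.2.3)

Topic `NumberTheory/EllipticCurves`; sibling proof file of `HeegnerModuleIndex.lean` (statement file
untouched; the discharge lives here as `IwasawaSelmerProofs.lean` does for `conjH1_of_mem`). Seat
`bsd-littype-05` (literature-prover, re-seat g3; `ledger fact claim` #1 on the fact). Consumers: every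
Heegner point main conjecture binder of the tree quantifies over `D : LambdaAdicSelmerData` (Howard
Thm B, CGS Thm C, KY Thm B / Thm 5.2.1, Castella 2024 Thm 1.3), and the route `VerticalKolyvaginBound`'s
stub `stub_towerData` (T) names the existence half as one of its two inputs.

## What is proved (theorems only; the model is built inside the existence proof)

* **Uniqueness with NO hypothesis on `γ`** (`LambdaAdicSelmerData.proj_smul_eq_evalT`,
  `LambdaAdicSelmerData.exists_linearEquiv`): for EVERY datum `D` the `Λ`-action is levelwise the
  truncated evaluation, `proj n (f • s) k = Σ_{i < k pⁿ} coeff_i(f) (conj_γ − 1)^i (proj n s k)`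
  (`IwasawaDual.evalT`), from the axioms `proj_X`, `proj_C` and `proj_cont` alone (write
  `f = Σ_{i<kpⁿ} C(coeff_i f) Xⁱ + g`; `g` kills the `(n,k)` level by `proj_cont`); hence any two data
  are isomorphic compatibly with all projections (both project bijectively onto the norm-compatible
  compact Selmer families, `ext`/`surj`) — Lang, Ch. 5 §1 Thm. 1.1: a compatible system of
  `ℤ_p[X]/(X^N, p^k)`-modules IS a `Λ`-module, in one way.
* **Existence for a topological generator `γ`** (`LambdaAdicSelmerDataExists.nonempty_lambdaAdicSelmerData`):
  carrier = the norm-compatible families of compact Selmer elements inside `∏_n ∏_k H¹(K_n, E[p^k])`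
  (Perrin-Riou's `lim←` along the corestrictions, in the convention of `proj_norm`), kept opaque with
  its membership characterization; `Λ`-action = the truncated evaluation componentwise, legitimate
  because `(conj_γ − 1)^{k pⁿ} = 0` on `H¹(K_n, E[p^k])` (Level file: `γ^{pⁿ} ∈ Gal(K̄/K_n)` acts
  trivially, `p^k` kills the level) — no topology on the levels is used; it preserves the carrier
  (Level file, Part 3, and `IwasawaDual.evalT_of_le` for the change of truncation); module axioms from
  the `evalT` algebra (`Module.ofMinimalAxioms`); the ten fields of `LambdaAdicSelmerData` are then
  definitional or one-line (`evalT_X`, `evalT_C`, the truncation).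
* `lambdaAdicSelmerData_exists_unique_holds : W.lambdaAdicSelmerData_exists_unique κ γ` — THE DISCHARGE.
No definition, no named fact, no `instance` (local `letI` inside one proof), no notation.
HONEST FRAMING: a CONSTRUCTION with no arithmetic content; it removes one named input from the trust
base of the Heegner-point binders and of `stub_towerData`; BSD is not advanced by it.

## References
* [PerrinRiou1987BSMF] B. Perrin-Riou, Bull. SMF 115 (1987), §0 pp. 401–402 (`S_p(L)`, `𝔖_p(L)`:
  "la limite projective des `S_p(F')` … induits par la corestriction … des `ℤ_p`-modules compacts").
* [Howard2004HeegnerKolyvagin] B. Howard, Compositio 140 (2004), §1 and Def. 3.2.3 (`H¹(K, 𝐓)`).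
* [Lang1990] S. Lang, *Cyclotomic Fields I and II*, Ch. 5 §1 Thm. 1.1. [GreenbergLNM1716] §1 (p. 60).
* Tree: `LambdaAdicSelmerDataLevelProofs.lean`, `IwasawaDualModule.lean`,
  `Kato2004/IwasawaCohomology{Exists,Unique}Proofs.lean` (the same pattern for `𝐇¹_Γ(T_pW)`).
-/

set_option autoImplicit false

noncomputable section

open scoped Classical

open Literature.NumberTheory.EllipticCurves Literature.NumberTheory.EllipticCurves.IwasawaDual
  Literature.NumberTheory.GaloisRepresentations PowerSeries

universe u

namespace WeierstrassCurve

/-! ## Part 1. The `Λ`-action of ANY datum is levelwise the truncated evaluation; uniqueness -/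

namespace LambdaAdicSelmerData

open LambdaAdicSelmerDataExists

variable {K : Type u} [Field K] [NumberField K] {W : WeierstrassCurve K} {p : ℕ} [Fact p.Prime]
  {κ : ZpExtension K p} {γ : Field.absoluteGaloisGroup K} (D : W.LambdaAdicSelmerData κ γ)

/-- `T^j` acts levelwise as `(conj_γ − 1)^j` (iterate `proj_X`). [cite: PerrinRiou1987BSMF, §0 p. 402] -/
theorem proj_X_pow_smul {n k : ℕ}
    {ψ : AddMonoid.End (W.torsionH1Over ((p : ℤ) ^ k) (κ.layerSubgroup n))}
    (hψ : ∀ y, ψ y = Literature.NumberTheory.EllipticCurves.conjH1 (κ.layerSubgroup n) (geomTorsion W ((p : ℤ) ^ k)) γ y - y) (j : ℕ) (s : D.S) :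
    D.proj n (((PowerSeries.X : IwasawaAlgebra p) ^ j) • s) k = (ψ ^ j) (D.proj n s k) := by
  induction j generalizing s with
  | zero => rw [pow_zero, one_smul, pow_zero]; rfl
  | succ j ih =>
    rw [pow_succ, mul_smul, ih ((PowerSeries.X : IwasawaAlgebra p) • s), D.proj_X n s, pow_succ,
      AddMonoid.End.coe_mul, Function.comp_apply, hψ]
    rfl

/-- Constants act levelwise through `ℤ_p → ℤ/p^k`: `proj n (C c • t) k = (c mod p^k) • proj n t k`
(`proj_C`, as the tree's `IwasawaDual.zpT`). [cite: PerrinRiou1987BSMF, §0 p. 401] -/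
theorem proj_C_smul_apply (n k : ℕ) (c : ℤ_[p]) (t : D.S) :
    D.proj n ((PowerSeries.C c : IwasawaAlgebra p) • t) k = zpT p k c (D.proj n t k) := by
  rw [D.proj_C n t c, zpT_def]
  simp only [WeierstrassCurve.padicPi, AddMonoidHom.pi_apply, AddMonoidHom.coe_comp,
    Function.comp_apply, Pi.evalAddMonoidHom_apply, zsmulAddGroupHom_apply, natCast_zsmul]

/-- **The `Λ`-action of ANY datum is levelwise the truncated evaluation** (rigidity of the pin):
`proj n (f • s) k = Σ_{i < k pⁿ} coeff_i(f) · ψ^i (proj n s k)` = `IwasawaDual.evalT` for `ψ = conj_γ − 1`.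
Proof: `f = Σ_{i<kpⁿ} C(coeff_i f) Xⁱ + g` with `coeff_i g = 0` for `i < k pⁿ`, so `g` kills the `(n,k)`
level (`proj_cont`), and the polynomial part is computed by `proj_X_pow_smul` / `proj_C_smul_apply`.
No hypothesis on `γ`. [cite: Lang1990, Ch. 5 §1 Thm. 1.1] [cite: PerrinRiou1987BSMF, §0 p. 402] -/
theorem proj_smul_eq_evalT {n k : ℕ}
    {ψ : AddMonoid.End (W.torsionH1Over ((p : ℤ) ^ k) (κ.layerSubgroup n))}
    (hψ : ∀ y, ψ y = Literature.NumberTheory.EllipticCurves.conjH1 (κ.layerSubgroup n) (geomTorsion W ((p : ℤ) ^ k)) γ y - y) (f : IwasawaAlgebra p) (s : D.S) :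
    D.proj n (f • s) k = evalT p ψ (k * p ^ n) k f (AddMonoidHom.id _) (D.proj n s k) := by
  set N := k * p ^ n with hN
  set fN : IwasawaAlgebra p :=
    ∑ j ∈ Finset.range N, PowerSeries.C (coeff j f) * (PowerSeries.X : IwasawaAlgebra p) ^ j with hfN
  have htail : ∀ i < N, coeff i (f - fN) = 0 := fun i hi ↦ by
    rw [map_sub, hfN, map_sum]
    simp only [coeff_C_mul_X_pow, Finset.sum_ite_eq, Finset.mem_range, hi, if_true, sub_self]
  have hsplit : f • s = fN • s + (f - fN) • s := by rw [← add_smul, add_sub_cancel]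
  rw [hsplit, map_add, Pi.add_apply, D.proj_cont n k s (f - fN) htail, add_zero, hfN, Finset.sum_smul,
    map_sum, Finset.sum_apply, evalT_def]
  refine Finset.sum_congr rfl fun j _ ↦ ?_
  rw [mul_smul, proj_C_smul_apply, D.proj_X_pow_smul hψ, AddMonoidHom.id_apply]

/-- The family of projections of an element is a norm-compatible family of compact Selmer elements,
hence lifts to any other datum. [cite: PerrinRiou1987BSMF, §0 p. 402] -/
theorem exists_proj_eq (D' : W.LambdaAdicSelmerData κ γ) (s : D.S) :
    ∃ s' : D'.S, ∀ n, D'.proj n s' = D.proj n s :=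
  D'.surj (fun n ↦ D.proj n s) (fun n ↦ D.proj_mem n s) (fun n ↦ D.proj_norm n s)

/-- **Uniqueness of `𝔖_p(K_∞)` as a pinned `Λ`-module**: any two data are isomorphic by a `Λ`-linear
isomorphism compatible with all the projections (both project bijectively onto the norm-compatible
families — `ext`, `surj` — and both actions are levelwise, `proj_smul_eq_evalT`). No hypothesis on `γ`.
[cite: PerrinRiou1987BSMF, §0 p. 402] [cite: Lang1990, Ch. 5 §1 Thm. 1.1] -/
theorem exists_linearEquiv (D' : W.LambdaAdicSelmerData κ γ) :
    ∃ e : D.S ≃ₗ[IwasawaAlgebra p] D'.S, ∀ n s, D'.proj n (e s) = D.proj n s := by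
  have hψex : ∀ n k : ℕ, ∃ ψ : AddMonoid.End (W.torsionH1Over ((p : ℤ) ^ k) (κ.layerSubgroup n)),
      ∀ y, ψ y = Literature.NumberTheory.EllipticCurves.conjH1 (κ.layerSubgroup n) (geomTorsion W ((p : ℤ) ^ k)) γ y - y :=
    fun n k ↦ ⟨Literature.NumberTheory.EllipticCurves.conjH1 (κ.layerSubgroup n) (geomTorsion W ((p : ℤ) ^ k)) γ - AddMonoidHom.id _, fun _ ↦ rfl⟩
  choose ψ hψ using hψex
  choose e he using fun s ↦ D.exists_proj_eq D' s
  have extD : ∀ {a b : D.S}, (∀ n, D.proj n a = D.proj n b) → a = b :=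
    fun h ↦ D.proj_injective (funext fun n ↦ h n)
  have extD' : ∀ {a b : D'.S}, (∀ n, D'.proj n a = D'.proj n b) → a = b :=
    fun h ↦ D'.proj_injective (funext fun n ↦ h n)
  have hadd : ∀ x y, e (x + y) = e x + e y := fun x y ↦
    extD' fun n ↦ by rw [he, map_add, map_add, he, he]
  have hsmul : ∀ (f : IwasawaAlgebra p) (x : D.S), e (f • x) = f • e x := fun f x ↦
    extD' fun n ↦ funext fun k ↦ by
      rw [he, D.proj_smul_eq_evalT (hψ n k), D'.proj_smul_eq_evalT (hψ n k), he]
  let eₗ : D.S →ₗ[IwasawaAlgebra p] D'.S := { toFun := e, map_add' := hadd, map_smul' := hsmul }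
  have hinj : Function.Injective eₗ := fun x y h ↦
    extD fun n ↦ by rw [← he x n, ← he y n]; exact congrArg (D'.proj n) h
  have hsurj : Function.Surjective eₗ := fun y ↦ by
    obtain ⟨x, hx⟩ := D'.exists_proj_eq D y
    exact ⟨x, extD' fun n ↦ (he x n).trans (hx n)⟩
  exact ⟨LinearEquiv.ofBijective eₗ ⟨hinj, hsurj⟩, fun n s ↦ he s n⟩

end LambdaAdicSelmerData

/-! ## Part 2. Existence: `lim←_n S_p(E/K_n)` inside `∏_n ∏_k H¹(K_n, E[p^k])` with the truncated action -/

namespace LambdaAdicSelmerDataExists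

variable {K : Type u} [Field K] [NumberField K] (W : WeierstrassCurve K) (p : ℕ) [Fact p.Prime]
  (κ : ZpExtension K p) {γ : Field.absoluteGaloisGroup K}

/-- **Existence of `𝔖_p(K_∞)` as a `LambdaAdicSelmerData`** for a topological generator `γ`
(Perrin-Riou 1987 §0: `𝔖_p(K_∞)` "des `ℤ_p`-modules compacts … limite projective"; Howard 2004
Def. 3.2.3). The model: carrier = the families `(x_n)_n`, `x_n ∈ S_p(E/K_n) ⊆ ∏_k H¹(K_n, E[p^k])`
(`compactSelmerOver`) with `res x_n = Σ_{i<p} conj_{γ^{pⁿ i}} x_{n+1}` (`proj_norm`'s convention); on the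
`(n, k)` component `f ∈ ℤ_p⟦T⟧` acts by `Σ_{i<k pⁿ} coeff_i(f) (conj_γ − 1)^i` (`IwasawaDual.evalT`), which
is legitimate since `(conj_γ − 1)^{k pⁿ} = 0` there (`psi_pow_apply_eq_zero`) and preserves the carrier
(Selmer `conj`-stability; `p_*`, `res`, `conj_{γ^j}` commute with `conj_γ − 1`; `evalT_of_le`); module
axioms by `Module.ofMinimalAxioms` from the `evalT` algebra; projections = coordinates.
[cite: PerrinRiou1987BSMF, §0 p. 402] [cite: Howard2004HeegnerKolyvagin, Def. 3.2.3]
[cite: Lang1990, Ch. 5 §1 Thm. 1.1] -/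
theorem nonempty_lambdaAdicSelmerData (hγ : κ.IsTopGenerator γ) :
    Nonempty (W.LambdaAdicSelmerData κ γ) := by
  -- (0) `ψ_{n,k} = conj_γ − 1` on `H¹(K_n, E[p^k])`, kept opaque with its characterization
  have hψex : ∀ n k : ℕ, ∃ ψ : AddMonoid.End (W.torsionH1Over ((p : ℤ) ^ k) (κ.layerSubgroup n)),
      ∀ y, ψ y = Literature.NumberTheory.EllipticCurves.conjH1 (κ.layerSubgroup n) (geomTorsion W ((p : ℤ) ^ k)) γ y - y :=
    fun n k ↦ ⟨Literature.NumberTheory.EllipticCurves.conjH1 (κ.layerSubgroup n) (geomTorsion W ((p : ℤ) ^ k)) γ - AddMonoidHom.id _, fun _ ↦ rfl⟩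
  choose ψ hψ using hψex
  have htor : ∀ (n k : ℕ) (y : W.torsionH1Over ((p : ℤ) ^ k) (κ.layerSubgroup n)), p ^ k • y = 0 :=
    fun n k y ↦ pow_nsmul_eq_zero W p _ k y
  have hnil : ∀ (n k : ℕ) (y : W.torsionH1Over ((p : ℤ) ^ k) (κ.layerSubgroup n)),
      (ψ n k ^ (k * p ^ n)) y = 0 :=
    fun n k y ↦ psi_pow_apply_eq_zero (hψ n k) (pow_mem_layerSubgroup p κ hγ n) y
  -- (1) the carrier `lim←_n S_p(E/K_n)`, kept opaque with its membership characterization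
  obtain ⟨Sf, hSf⟩ : ∃ Sf : AddSubgroup (Π n k : ℕ, W.torsionH1Over ((p : ℤ) ^ k) (κ.layerSubgroup n)),
      ∀ x, x ∈ Sf ↔ (∀ n, x n ∈ W.compactSelmerOver (κ.layerSubgroup n) p) ∧
        ∀ n, W.resPi p (κ.layerSubgroup_antitone (Nat.le_succ n)) (x n) =
          ∑ i ∈ Finset.range p, W.conjPi p (κ.layerSubgroup (n + 1)) (γ ^ (p ^ n * i)) (x (n + 1)) :=
    ⟨{ carrier := {x | (∀ n, x n ∈ W.compactSelmerOver (κ.layerSubgroup n) p) ∧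
          ∀ n, W.resPi p (κ.layerSubgroup_antitone (Nat.le_succ n)) (x n) =
            ∑ i ∈ Finset.range p, W.conjPi p (κ.layerSubgroup (n + 1)) (γ ^ (p ^ n * i)) (x (n + 1))}
       zero_mem' := ⟨fun n ↦ zero_mem _, fun n ↦ by simp⟩
       add_mem' := fun {x y} hx hy ↦ ⟨fun n ↦ add_mem (hx.1 n) (hy.1 n), fun n ↦ by
          rw [Pi.add_apply, map_add, hx.2 n, hy.2 n, ← Finset.sum_add_distrib]
          exact Finset.sum_congr rfl fun i _ ↦ (map_add _ _ _).symm⟩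
       neg_mem' := fun {x} hx ↦ ⟨fun n ↦ neg_mem (hx.1 n), fun n ↦ by
          rw [Pi.neg_apply, map_neg, hx.2 n, ← Finset.sum_neg_distrib]
          exact Finset.sum_congr rfl fun i _ ↦ (map_neg _ _).symm⟩ }, fun _ ↦ Iff.rfl⟩
  -- (2) the truncated action preserves the carrier
  have hmem : ∀ (f : IwasawaAlgebra p) (x : Π n k : ℕ, W.torsionH1Over ((p : ℤ) ^ k) (κ.layerSubgroup n)),
      x ∈ Sf → (fun n k ↦ evalT p (ψ n k) (k * p ^ n) k f (AddMonoidHom.id _) (x n k)) ∈ Sf := by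
    intro f x hx
    rw [hSf] at hx ⊢
    refine ⟨fun n ↦ ?_, fun n ↦ ?_⟩
    · -- compact Selmer: Selmer at each level (`conj`-stability), `p_*`-compatible (transport)
      have hxn := (W.mem_compactSelmerOver_iff (κ.layerSubgroup n) p (x n)).1 (hx.1 n)
      rw [mem_compactSelmerOver_iff]
      refine ⟨fun k ↦ evalT_mem_selmerTorsionOver p (hψ n k) _ f (hxn.1 k), fun k ↦ ?_⟩
      rw [map_evalT_id _ _ (W.reduceTorsionH1 p k (κ.layerSubgroup n))
        (reduceTorsionH1_psi p (hψ n (k + 1)) (hψ n k)) ((k + 1) * p ^ n) (k + 1) f (x n (k + 1)),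
        hxn.2 k]
      exact evalT_of_le (Nat.mul_le_mul_right _ (Nat.le_succ k)) (Nat.le_succ k) f _
        (hnil n k (x n k)) (htor n k (x n k))
    · -- norm compatibility (transport along `res` and `conj_{γ^j}`; truncation change by `evalT_of_le`)
      funext k
      have hres : W.resPi p (κ.layerSubgroup_antitone (Nat.le_succ n))
          (fun k ↦ evalT p (ψ n k) (k * p ^ n) k f (AddMonoidHom.id _) (x n k)) k =
          evalT p (ψ (n + 1) k) (k * p ^ n) k f (AddMonoidHom.id _)
            (W.resPi p (κ.layerSubgroup_antitone (Nat.le_succ n)) (x n) k) := by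
        simp only [WeierstrassCurve.resPi, AddMonoidHom.pi_apply, AddMonoidHom.coe_comp,
          Function.comp_apply, Pi.evalAddMonoidHom_apply]
        exact map_evalT_id _ _ _
          (resOfLe_psi p (κ.layerSubgroup_antitone (Nat.le_succ n)) (hψ n k) (hψ (n + 1) k)) _ _ f _
      have hconj : ∀ i, W.conjPi p (κ.layerSubgroup (n + 1)) (γ ^ (p ^ n * i))
          (fun k ↦ evalT p (ψ (n + 1) k) (k * p ^ (n + 1)) k f (AddMonoidHom.id _) (x (n + 1) k)) k =
          evalT p (ψ (n + 1) k) (k * p ^ (n + 1)) k f (AddMonoidHom.id _)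
            (W.conjPi p (κ.layerSubgroup (n + 1)) (γ ^ (p ^ n * i)) (x (n + 1)) k) := fun i ↦ by
        simp only [WeierstrassCurve.conjPi, AddMonoidHom.pi_apply, AddMonoidHom.coe_comp,
          Function.comp_apply, Pi.evalAddMonoidHom_apply]
        exact map_evalT_id _ _ _
          (conjH1_psi_of_commute p (Commute.pow_left (Commute.refl γ) _) (hψ (n + 1) k)) _ _ f _
      -- the restricted class comes from level `n`: it is killed by `ψ^{k pⁿ}` already
      have hresN : (ψ (n + 1) k ^ (k * p ^ n))
          (W.resPi p (κ.layerSubgroup_antitone (Nat.le_succ n)) (x n) k) = 0 := by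
        have h := map_pow_apply (ψ n k) (ψ (n + 1) k)
          (Literature.NumberTheory.EllipticCurves.resOfLe (geomTorsion W ((p : ℤ) ^ k))
            (κ.layerSubgroup_antitone (Nat.le_succ n)))
          (resOfLe_psi p (κ.layerSubgroup_antitone (Nat.le_succ n)) (hψ n k) (hψ (n + 1) k))
          (k * p ^ n) (x n k)
        simp only [WeierstrassCurve.resPi, AddMonoidHom.pi_apply, AddMonoidHom.coe_comp,
          Function.comp_apply, Pi.evalAddMonoidHom_apply]
        rw [← h, hnil n k (x n k), map_zero]
      rw [hres, Finset.sum_apply, Finset.sum_congr rfl fun i _ ↦ hconj i,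
        ← evalT_of_le (Nat.mul_le_mul_left k (Nat.pow_le_pow_right (Fact.out : p.Prime).pos
          (Nat.le_succ n))) le_rfl f _ hresN (htor (n + 1) k _), congrFun (hx.2 n) k, Finset.sum_apply]
      exact evalT_id_sum _ _ _ f _ _
  -- (3) the `Λ`-module structure (local instances; axioms from the `evalT` algebra)
  letI instSMul : SMul (IwasawaAlgebra p) Sf := ⟨fun f x ↦ ⟨_, hmem f x.1 x.2⟩⟩
  have hsmul : ∀ (f : IwasawaAlgebra p) (x : Sf) (n k : ℕ), (f • x).1 n k =
      evalT p (ψ n k) (k * p ^ n) k f (AddMonoidHom.id _) (x.1 n k) := fun _ _ _ _ ↦ rfl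
  letI instModule : Module (IwasawaAlgebra p) Sf := Module.ofMinimalAxioms
    (fun f x y ↦ Subtype.ext <| funext fun n ↦ funext fun k ↦ by
      rw [hsmul]
      change _ = (f • x).1 n k + (f • y).1 n k
      rw [hsmul, hsmul]
      exact evalT_add_right _ _ f _ _ _)
    (fun f g x ↦ Subtype.ext <| funext fun n ↦ funext fun k ↦ by
      rw [hsmul]
      change _ = (f • x).1 n k + (g • x).1 n k
      rw [hsmul, hsmul]
      exact evalT_add_left f g _ (htor n k _))
    (fun f g x ↦ Subtype.ext <| funext fun n ↦ funext fun k ↦ by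
      rw [hsmul, hsmul, hsmul]
      exact evalT_id_mul _ f g (hnil n k _) (htor n k _))
    (fun x ↦ Subtype.ext <| funext fun n ↦ funext fun k ↦ by
      rw [hsmul]
      exact evalT_one _ (hnil n k _) (htor n k _))
  -- (4) the datum: projections = coordinates
  refine ⟨
    { S := Sf
      proj := fun n ↦ (Pi.evalAddMonoidHom _ n).comp Sf.subtype
      proj_mem := fun n s ↦ ((hSf s.1).1 s.2).1 n
      proj_X := fun n s ↦ ?_
      proj_C := fun n s c ↦ ?_
      proj_cont := fun n k s f hf ↦ ?_
      proj_norm := fun n s ↦ ((hSf s.1).1 s.2).2 n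
      ext := fun s hs ↦ Subtype.ext (funext fun n ↦ hs n)
      surj := fun x hsel hnorm ↦ ⟨⟨x, (hSf x).2 ⟨hsel, hnorm⟩⟩, fun _ ↦ rfl⟩ }⟩
  · -- `T ↦ conj_γ − 1` (`evalT_X`)
    funext k
    change ((PowerSeries.X : IwasawaAlgebra p) • s).1 n k = _
    rw [hsmul, evalT_X _ (hnil n k _) (htor n k _), AddMonoidHom.id_apply, hψ]
    rfl
  · -- constants through `ℤ_p → ℤ/p^k` (`evalT_C`)
    funext k
    change ((PowerSeries.C c : IwasawaAlgebra p) • s).1 n k = _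
    rw [hsmul, evalT_C c _ (hnil n k _) (htor n k _), AddMonoidHom.id_apply, zpT_def]
    simp only [WeierstrassCurve.padicPi, AddMonoidHom.pi_apply, AddMonoidHom.coe_comp,
      Function.comp_apply, Pi.evalAddMonoidHom_apply, zsmulAddGroupHom_apply, natCast_zsmul]
    rfl
  · -- continuity = the truncation at `k pⁿ`
    change (f • s).1 n k = 0
    rw [hsmul, evalT_def]
    exact Finset.sum_eq_zero fun i hi ↦ by rw [hf i (Finset.mem_range.mp hi), zpT_zero_left]

end LambdaAdicSelmerDataExists

/-! ## Part 3. The discharge -/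

section Discharge

variable {K : Type u} [Field K] [NumberField K] (W : WeierstrassCurve K) {p : ℕ} [Fact p.Prime]
  (κ : ZpExtension K p) (γ : Field.absoluteGaloisGroup K)

/-- **Discharge of `WeierstrassCurve.lambdaAdicSelmerData_exists_unique`** (Perrin-Riou 1987 §0
p. 402; Howard 2004 Def. 3.2.3): for `γ` a topological generator the `Λ`-adic Selmer datum
`𝔖_p(K_∞) = lim←_n S_p(E/K_n)` exists (`LambdaAdicSelmerDataExists.nonempty_lambdaAdicSelmerData`),
and any two data are `Λ`-isomorphic compatibly with the projections
(`LambdaAdicSelmerData.exists_linearEquiv`). [cite: PerrinRiou1987BSMF, §0 p. 402]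
[cite: Howard2004HeegnerKolyvagin, §1 and Def. 3.2.3] -/
theorem lambdaAdicSelmerData_exists_unique_holds : W.lambdaAdicSelmerData_exists_unique κ γ :=
  ⟨fun hγ ↦ LambdaAdicSelmerDataExists.nonempty_lambdaAdicSelmerData W p κ hγ,
    fun D D' ↦ D.exists_linearEquiv D'⟩

end Discharge

end WeierstrassCurve

end
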